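import Summits.KontsevichZagierPeriods.KontsevichZagierPeriods.Theorems.SoloBlindZetaThreeCharts
import Summits.KontsevichZagierPeriods.KontsevichZagierPeriods.Theorems.SoloBlindZetaBox
import Summits.KontsevichZagierPeriods.KontsevichZagierPeriods.Theorems.SoloBlindZetaTwoReps
import HarnessLib

/-!
# Beukers' `ζ(3)`-integral inside the Kontsevich–Zagier rules: `[I₀] = 2·[B₃]`

Let `I₀ = [(0,1)³, 1/(1 - (1-xy)w)]` be the `n = 0` case of Beukers' family of triple integrals
from his proof of Apéry's theorem (`∫₀¹ dw/(1-(1-xy)w) = -log(xy)/(1-xy)`, value `2ζ(3)`), and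
`B₃ = [(0,1)³, 1/(1-xyz)]` Beukers' box of `ζ(3)` (`SoloBlindZetaBox.boxZetaRep 3`).  The two
`ℚ`-rational representations are genuinely different three-dimensional integrals; we connect them
by an explicit chain of **six moves** (`beukersRep_sub_two_boxThree`):

1. `Φ(x,y,w) = (x,y,1-(1-xy)w)` (rule (2), Jacobian `1-xy` absorbed): `[I₀] = [W, g]`,
   `W = {xy < t < 1}`, `g = 1/(t(1-xy))`;
2. dissection of `W` at `t = x` (rule (3)): `[W, g] = [U, g] + [D, g]`, `U = {x < t}`,
   `D = {xy < t < x}`;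
3. `Ψ(s,y,t) = (ts,y,t)` (rule (2), Jacobian `t`): `[B₃] = [U, g]`;
4. the coordinate swap `x ↔ y` (rule (2)): `[U, g] = [U', g]`, `U' = {y < t}`;
5. `Θ(x,y,t') = (x,y,xt')` (rule (2), Jacobian `x`): `[U', g] = [D, g]`.

Hence `[I₀] - 2[B₃] ∈ relations`, so `I₀` lies on the `ζ(3)`-line of `SoloBlindLines`, where the
Kontsevich–Zagier conjecture holds by Apéry's theorem; and `value I₀ = 2ζ(3)` is *read off* from
the moves (`beukersRep_value`) — a period identity proved by KZ's three rules alone.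
-/

noncomputable section

namespace Summit.KontsevichZagierPeriods.KontsevichZagierPeriods.Theorems

open Set MeasureTheory
open Literature.ModelTheory.ExponentialFields (IsSemialgebraic)
open MvPolynomial (aeval X)
open Literature.NumberTheory.Transcendental
open Literature.NumberTheory.Transcendental.KZ

namespace SoloBlind

/-- `2 ≤ 3`. -/
theorem two_le_three : 2 ≤ 3 := by norm_num

/-- `B₃`, Beukers' box of `ζ(3)`. -/
abbrev boxThree : IntegralRep 3 := boxZetaRep 3 two_le_three

/-- The integrand of `B₃` in coordinates. -/
theorem boxThree_integrand (w : Fin 3 → ℝ) : boxThree.integrand w = 1 / (1 - w 0 * w 1 * w 2) := by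
  show 1 / (1 - ∏ i, w i) = _
  rw [Fin.prod_univ_three]

/-- The common integrand `g(x,y,t) = 1/(t(1-xy))` of the wedge pieces. -/
def wedgeFun (v : Fin 3 → ℝ) : ℝ := 1 / (v 2 * (1 - v 0 * v 1))

/-- `g(v) = 1/(v₂(1-v₀v₁))`. -/
theorem wedgeFun_apply (v : Fin 3 → ℝ) : wedgeFun v = 1 / (v 2 * (1 - v 0 * v 1)) := rfl

/-- On the box the denominator of `g` is nonzero. -/
theorem wedgeDen_ne_zero {v : Fin 3 → ℝ} (hv : v ∈ kzOpenBox 3) : v 2 * (1 - v 0 * v 1) ≠ 0 :=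
  mul_ne_zero (hv 2).1.ne' (by linarith [mul_lt_one_of_mem_kzOpenBox hv])

/-- A tie `vᵢ = vⱼ` (`i ≠ j`) is Lebesgue-null in `ℝᵐ`. -/
theorem volume_setOf_apply_eq {m : ℕ} {i j : Fin m} (hij : i ≠ j) :
    volume {t : Fin m → ℝ | t i = t j} = 0 := by
  let L : (Fin m → ℝ) →ₗ[ℝ] ℝ :=
    LinearMap.proj (R := ℝ) (φ := fun _ : Fin m => ℝ) i -
      LinearMap.proj (R := ℝ) (φ := fun _ : Fin m => ℝ) j
  have hS : LinearMap.ker L ≠ ⊤ := by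
    intro h
    have h1 : (Pi.single i 1 : Fin m → ℝ) ∈ LinearMap.ker L := h ▸ Submodule.mem_top
    rw [LinearMap.mem_ker] at h1
    simp [L, hij.symm] at h1
  refine measure_mono_null (fun t ht => ?_) (Measure.addHaar_submodule volume (LinearMap.ker L) hS)
  have ht' : t i = t j := ht
  rw [SetLike.mem_coe, LinearMap.mem_ker]
  simp [L, ht']

/-! ## The pieces `[U, g]`, `[U', g]`, `[D, g]` -/

/-- `B₃`'s integrand is the pull-back of `g` along `Ψ`, times the Jacobian `t`. -/
theorem boxThree_integrand_eq {w : Fin 3 → ℝ} (hw : w ∈ kzOpenBox 3) :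
    boxThree.integrand w = wedgeFun (mulChart w) * w 2 := by
  have h2 : w 2 ≠ 0 := (hw 2).1.ne'
  have hd : 1 - w 0 * w 1 * w 2 ≠ 0 := by
    have h := BoxIntegral.prod_mem_Ioo (n := 3) (by norm_num) hw
    rw [Fin.prod_univ_three] at h
    linarith [h.2]
  rw [boxThree_integrand]
  simp only [wedgeFun, mulChart, Matrix.cons_val_zero, Matrix.cons_val_one, Matrix.cons_val_two,
    Matrix.head_cons, Matrix.tail_cons]
  rw [show 1 - w 2 * w 0 * w 1 = 1 - w 0 * w 1 * w 2 by ring]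
  field_simp

/-- **`[U, g]`**, with convergence transported from `B₃` along `Ψ`. -/
def upperRep : IntegralRep 3 :=
  ratRep upperWedge wedgeFun 1 (X 2 * (1 - X 0 * X 1)) isSemialgebraic_upperWedge
    (fun v hv => by simpa using wedgeDen_ne_zero hv.1) (fun v _ => by simp [wedgeFun])
    (by
      rw [← image_mulChart]
      exact (integrableOn_iff_of_chart (measurableSet_kzOpenBox 3)
        (fun w _ => hasFDerivAt_mulChart w) injOn_mulChart (fun _ hw => abs_det_mulDeriv hw)
        (f := boxThree.integrand) (g := wedgeFun) fun _ hw => boxThree_integrand_eq hw).mpr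
        boxThree.integrableOn)

/-- **Move 3**: `[B₃] ≡ [U, g]` along `Ψ`. -/
theorem boxThree_equiv_upperRep : Equivalent boxThree upperRep :=
  equivalent_of_chart isSemialgebraicMapOn_mulChart (fun w _ => hasFDerivAt_mulChart w)
    injOn_mulChart image_mulChart (fun _ hw => abs_det_mulDeriv hw)
    (fun _ hw => boxThree_integrand_eq hw) rfl (fun _ _ => rfl) rfl fun _ _ => rfl

/-- **`[U', g]`** as the coordinate swap `x ↔ y` of `[U, g]`. -/
def sideRep : IntegralRep 3 := upperRep.reindex (Equiv.swap 0 1)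

/-- The domain of `[U', g]` is `U'`. -/
theorem sideRep_domain : sideRep.domain = sideWedge := by
  have e2 : Equiv.swap (0 : Fin 3) 1 2 = 2 := Equiv.swap_apply_of_ne_of_ne (by decide) (by decide)
  ext w
  show (fun i => w (Equiv.swap 0 1 i)) ∈ upperWedge ↔ w ∈ sideWedge
  rw [upperWedge, sideWedge, mem_inter_iff, mem_inter_iff, mem_kzOpenBox_three,
    mem_kzOpenBox_three, mem_setOf_eq, mem_setOf_eq, Equiv.swap_apply_left,
    Equiv.swap_apply_right, e2]
  tauto

/-- The integrand of `[U', g]` is `g` (which is symmetric in `x, y`). -/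
theorem sideRep_integrand (w : Fin 3 → ℝ) : sideRep.integrand w = wedgeFun w := by
  have e2 : Equiv.swap (0 : Fin 3) 1 2 = 2 := Equiv.swap_apply_of_ne_of_ne (by decide) (by decide)
  show wedgeFun (fun i => w (Equiv.swap 0 1 i)) = wedgeFun w
  simp only [wedgeFun, Equiv.swap_apply_left, Equiv.swap_apply_right, e2, mul_comm (w 1) (w 0)]

/-- **Move 4**: `[U, g] - [U', g] ∈ relations` (a coordinate permutation). -/
theorem upperRep_sub_sideRep : of upperRep - of sideRep ∈ relations :=
  of_sub_of_reindex_mem_relations upperRep (Equiv.swap 0 1)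

/-- `g` on `U'` is the pull-back of `g` on `D` along `Θ`, times the Jacobian `x`. -/
theorem wedgeFun_eq_scale {w : Fin 3 → ℝ} (hw : w ∈ sideWedge) :
    wedgeFun w = wedgeFun (scaleChart w) * w 0 := by
  have h0 : w 0 ≠ 0 := (hw.1 0).1.ne'
  have h2 : w 2 ≠ 0 := (hw.1 2).1.ne'
  have hd : 1 - w 0 * w 1 ≠ 0 := by linarith [mul_lt_one_of_mem_kzOpenBox hw.1]
  simp only [wedgeFun, scaleChart, Matrix.cons_val_zero, Matrix.cons_val_one, Matrix.cons_val_two,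
    Matrix.head_cons, Matrix.tail_cons]
  field_simp

/-- `g` is integrable on `U'`. -/
theorem integrableOn_wedgeFun_sideWedge : IntegrableOn wedgeFun sideWedge := by
  have h := sideRep.integrableOn
  rw [sideRep_domain] at h
  exact h.congr_fun (fun w _ => sideRep_integrand w) measurableSet_sideWedge

/-- **`[D, g]`**, with convergence transported from `[U', g]` along `Θ`. -/
def lowerRep : IntegralRep 3 :=
  ratRep lowerWedge wedgeFun 1 (X 2 * (1 - X 0 * X 1)) isSemialgebraic_lowerWedge
    (fun v hv => by simpa using wedgeDen_ne_zero hv.1) (fun v _ => by simp [wedgeFun])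
    (by
      rw [← image_scaleChart]
      exact (integrableOn_iff_of_chart measurableSet_sideWedge
        (fun w _ => hasFDerivAt_scaleChart w) injOn_scaleChart (fun _ hw => abs_det_scaleDeriv hw)
        (f := wedgeFun) (g := wedgeFun) fun _ hw => wedgeFun_eq_scale hw).mpr
        integrableOn_wedgeFun_sideWedge)

/-- **Move 5**: `[U', g] ≡ [D, g]` along `Θ`. -/
theorem sideRep_equiv_lowerRep : Equivalent sideRep lowerRep :=
  equivalent_of_chart isSemialgebraicMapOn_scaleChart (fun w _ => hasFDerivAt_scaleChart w)
    injOn_scaleChart image_scaleChart (fun _ hw => abs_det_scaleDeriv hw)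
    (fun _ hw => wedgeFun_eq_scale hw) sideRep_domain (fun w _ => sideRep_integrand w) rfl
    fun _ _ => rfl

/-! ## The wedge `[W, g]` and Beukers' `I₀` -/

/-- `W ⊆ U ∪ D ∪ {t = x}`. -/
theorem beukersWedge_subset :
    beukersWedge ⊆ upperWedge ∪ lowerWedge ∪ {v : Fin 3 → ℝ | v 2 = v 0} := by
  rintro v ⟨hb, hlt⟩
  have hlt : v 0 * v 1 < v 2 := hlt
  rcases lt_trichotomy (v 0) (v 2) with h | h | h
  · exact Or.inl (Or.inl ⟨hb, h⟩)
  · exact Or.inr h.symm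
  · exact Or.inl (Or.inr ⟨hb, hlt, h⟩)

/-- `g` is integrable on `W`. -/
theorem integrableOn_wedgeFun_beukersWedge : IntegrableOn wedgeFun beukersWedge := by
  have h0 : volume {v : Fin 3 → ℝ | v 2 = v 0} = 0 :=
    volume_setOf_apply_eq (show (2 : Fin 3) ≠ 0 by decide)
  have hT : IntegrableOn wedgeFun {v : Fin 3 → ℝ | v 2 = v 0} := by
    rw [IntegrableOn, Measure.restrict_eq_zero.mpr h0]
    exact integrable_zero_measure
  have hU : IntegrableOn wedgeFun upperWedge := upperRep.integrableOn
  have hD : IntegrableOn wedgeFun lowerWedge := lowerRep.integrableOn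
  exact ((hU.union hD).union hT).mono_set beukersWedge_subset

/-- **`[W, g]`**, `W = {xy < t}`. -/
def beukersWedgeRep : IntegralRep 3 :=
  ratRep beukersWedge wedgeFun 1 (X 2 * (1 - X 0 * X 1)) isSemialgebraic_beukersWedge
    (fun v hv => by simpa using wedgeDen_ne_zero hv.1) (fun v _ => by simp [wedgeFun])
    integrableOn_wedgeFun_beukersWedge

/-- `U ⊆ W`. -/
theorem upperWedge_subset : upperWedge ⊆ beukersWedge := by
  rintro v ⟨hb, hlt⟩
  have hlt : v 0 < v 2 := hlt
  refine ⟨hb, ?_⟩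
  show v 0 * v 1 < v 2
  nlinarith [(hb 0).1, (hb 1).2]

/-- **Move 2** (rule (3)): `[W, g] - [U, g] - [D, g] ∈ relations`, the dissection at `t = x`. -/
theorem wedgeRep_sub_sub : of beukersWedgeRep - of upperRep - of lowerRep ∈ relations := by
  have h := of_sub_sum_of_mem_relations (Finset.univ : Finset (Fin 2)) beukersWedgeRep
    ![upperRep, lowerRep] (fun i _ => ?_) (fun i _ v _ => ?_) ?_ ?_
  · simpa [Fin.sum_univ_two, sub_sub] using h
  · fin_cases i
    · exact measure_mono_null (fun v hv => absurd (upperWedge_subset hv.1) hv.2) measure_empty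
    · exact measure_mono_null
        (fun v hv => absurd (show v ∈ beukersWedge from ⟨hv.1.1, hv.1.2.1⟩) hv.2) measure_empty
  · fin_cases i
    · rfl
    · rfl
  · refine measure_mono_null (fun v hv => ?_)
      (volume_setOf_apply_eq (show (2 : Fin 3) ≠ 0 by decide))
    obtain ⟨hW, hn⟩ := hv
    have hW : v ∈ beukersWedge := hW
    rcases beukersWedge_subset hW with (hU | hD) | hT
    · exact absurd (mem_biUnion (Finset.mem_univ (0 : Fin 2)) hU) hn
    · exact absurd (mem_biUnion (Finset.mem_univ (1 : Fin 2)) hD) hn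
    · exact hT
  · intro i _ j _ hij
    have hUD : upperWedge ∩ lowerWedge = ∅ :=
      eq_empty_of_forall_notMem fun v ⟨hU, hD⟩ => lt_asymm (show v 0 < v 2 from hU.2) hD.2.2
    fin_cases i <;> fin_cases j
    · exact absurd rfl hij
    · show volume (upperWedge ∩ lowerWedge) = 0
      rw [hUD, measure_empty]
    · show volume (lowerWedge ∩ upperWedge) = 0
      rw [inter_comm, hUD, measure_empty]
    · exact absurd rfl hij

/-- Beukers' integrand is the pull-back of `g` along `Φ`, times the Jacobian `1 - xy`. -/
theorem beukersFun_eq {w : Fin 3 → ℝ} (hw : w ∈ kzOpenBox 3) :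
    1 / (1 - (1 - w 0 * w 1) * w 2) = wedgeFun (beukersChart w) * (1 - w 0 * w 1) := by
  have hxy := mul_lt_one_of_mem_kzOpenBox hw
  have hd : 1 - w 0 * w 1 ≠ 0 := by linarith
  have hq : (1 - w 0 * w 1) * w 2 < 1 :=
    mul_lt_one_of_nonneg_of_lt_one_left (by linarith) (by linarith [mul_pos (hw 0).1 (hw 1).1])
      (hw 2).2.le
  have hq' : 1 - (1 - w 0 * w 1) * w 2 ≠ 0 := by linarith
  simp only [wedgeFun, beukersChart, Matrix.cons_val_zero, Matrix.cons_val_one, Matrix.cons_val_two,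
    Matrix.head_cons, Matrix.tail_cons]
  field_simp

/-- **Beukers' representation `I₀ = [(0,1)³, 1/(1 - (1-xy)w)]`**, with convergence transported
from `[W, g]` along `Φ`. -/
def beukersRep : IntegralRep 3 :=
  ratRep (kzOpenBox 3) (fun v => 1 / (1 - (1 - v 0 * v 1) * v 2)) 1
    (1 - (1 - X 0 * X 1) * X 2) (isSemialgebraic_kzOpenBox 3)
    (fun v hv => by
      have hq : (1 - v 0 * v 1) * v 2 < 1 :=
        mul_lt_one_of_nonneg_of_lt_one_left (by linarith [mul_lt_one_of_mem_kzOpenBox hv])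
          (by linarith [mul_pos (hv 0).1 (hv 1).1]) (hv 2).2.le
      have h : (0 : ℝ) < 1 - (1 - v 0 * v 1) * v 2 := by linarith
      simpa using h.ne')
    (fun v _ => by simp)
    (by
      have hW : IntegrableOn wedgeFun beukersWedge volume := beukersWedgeRep.integrableOn
      rw [← image_beukersChart] at hW
      exact (integrableOn_iff_of_chart (measurableSet_kzOpenBox 3)
        (fun w _ => hasFDerivAt_beukersChart w) injOn_beukersChart
        (fun _ hw => abs_det_beukersDeriv hw) (f := fun v => 1 / (1 - (1 - v 0 * v 1) * v 2))
        (g := wedgeFun) fun _ hw => beukersFun_eq hw).mp hW)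

/-- `I₀` is `ℚ`-rational in KZ's literal sense. -/
theorem isRational_beukersRep : beukersRep.IsRational := isRational_ratRep ..

/-- **Move 1**: `[I₀] ≡ [W, g]` along `Φ`. -/
theorem beukersRep_equiv_wedgeRep : Equivalent beukersRep beukersWedgeRep :=
  equivalent_of_chart isSemialgebraicMapOn_beukersChart (fun w _ => hasFDerivAt_beukersChart w)
    injOn_beukersChart image_beukersChart (fun _ hw => abs_det_beukersDeriv hw)
    (fun _ hw => beukersFun_eq hw) rfl (fun _ _ => rfl) rfl fun _ _ => rfl

/-! ## `[I₀] = 2·[B₃]` -/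

/-- **Beukers' integral inside the rules: `[I₀] - 2·[B₃] ∈ relations`.** -/
theorem beukersRep_sub_two_boxThree : of beukersRep - 2 • of boxThree ∈ relations := by
  have e : of beukersRep - 2 • of boxThree =
      (of beukersRep - of beukersWedgeRep) + (of beukersWedgeRep - of upperRep - of lowerRep) -
        2 • (of boxThree - of upperRep) - (of upperRep - of sideRep) -
        (of sideRep - of lowerRep) := by
    abel
  rw [e]
  exact sub_mem (sub_mem (sub_mem (add_mem beukersRep_equiv_wedgeRep wedgeRep_sub_sub)
    (AddSubgroup.nsmul_mem _ boxThree_equiv_upperRep 2)) upperRep_sub_sideRep)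
    sideRep_equiv_lowerRep

/-- **`∫_{(0,1)³} dxdydw/(1-(1-xy)w) = 2ζ(3)`**, read off from the moves. -/
theorem beukersRep_value : beukersRep.value = 2 * zetaValue 3 := by
  have h := relations_le_ker_eval_holds beukersRep_sub_two_boxThree
  rw [AddMonoidHom.mem_ker, map_sub, map_nsmul, eval_of, eval_of, sub_eq_zero] at h
  rw [h, nsmul_eq_mul, Nat.cast_ofNat]
  show 2 * (boxZetaRep 3 two_le_three).value = _
  rw [boxZetaRep_value]

/-- **The Kontsevich–Zagier conjecture for the pair (`I₀`, `B₃ ⊔ B₃`)**: `I₀` and the disjoint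
union of two copies of `B₃` (any representation KZ-equivalent to `[B₃] + [B₃]`) are
KZ-equivalent. -/
theorem kz_beukersRep {m : ℕ} (r' : IntegralRep m) (hr' : of r' - 2 • of boxThree ∈ relations) :
    Equivalent beukersRep r' := by
  have e : of beukersRep - of r' =
      (of beukersRep - 2 • of boxThree) - (of r' - 2 • of boxThree) := by abel
  show of beukersRep - of r' ∈ relations
  rw [e]
  exact sub_mem beukersRep_sub_two_boxThree hr'

end SoloBlind

end Summit.KontsevichZagierPeriods.KontsevichZagierPeriods.Theorems
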